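import Summits.Ventures.HSemireg.WedgeApolarSiegelWindowFine
import Summits.Ventures.HSemireg.WedgeApolarRadical

/-!
# Venture HSemireg — WHEN ARE THERE NO SIEGEL CLASSES IN CHARACTERISTIC `p`? `coSiegel_n ⊓ SI_n = ⊥ ⇔ Π_i (n_i + 1) = n + 1 ⇔ n + 1 = (d + 1)·p^k` with `d < p`
# (all base-`p` digits of `n` below the leading one are `p − 1`): the arithmetic reading of J15's count, by the digit recursion `Π(n) = (n mod p + 1)·Π(⌊n/p⌋)`

HONEST FRAMING. Part of the Lean index of the computation cell `pub-hsemireg` (seat p10 gen 20, Sunday typer «UNIFORM-IN-n»).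
Elementary arithmetic of base-`p` digits + the finite-dimensional linear algebra already in the tree ONLY: no variety, no cohomology theory, no sheaf, no Ext group, no
semiregularity map; nothing here says that HC / HC_CM / HC_AV holds; no Literature fact is declared or used.  Custodian versions as in `WedgeHankelSiegelIdeal` (1/3).

WHAT IS IN THE TREE.  J15 (`WedgeApolarSiegelWindowFine`): `card_filter_not_prime_dvd_choose` (Fine's count `Π_i (n_i+1)`), `finrank_coSiegel_inf_siegelIdeal_eq_sub_prod_digits`,
`coSiegel_inf_siegelIdeal_eq_bot_iff_prod_digits` (`⊥ ⇔ Π_i (n_i+1) = n+1`; «NOT typed: the reading»).  THIS FILE (namespace `Summit.Ventures.HSemireg.Wedge.KernelDuality` continued;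
imports J15, J7) types the reading:
* §260 `prod_digits_succ` (`Π(n) = (n mod p + 1)·Π(⌊n/p⌋)` for `n > 0`, `Π(0) = 1`), `prod_digits_succ_le_succ` (`Π(n) ≤ n + 1`, every `p ≥ 2`),
  **`prod_digits_succ_eq_succ_iff`** (`Π(n) = n + 1 ⇔ n < p ∨ (n mod p = p − 1 ∧ Π(⌊n/p⌋) = ⌊n/p⌋ + 1)`), **`prod_digits_succ_eq_succ_iff_exists`**
  (`Π(n) = n + 1 ⇔ ∃ k d, d < p ∧ n + 1 = (d+1)·p^k`).
* §261 **`coSiegel_inf_siegelIdeal_eq_bot_iff_exists_digits`: in characteristic `p`, `coSiegel_n ⊓ SI_n = ⊥ ⇔ ∃ k d, d < p ∧ n + 1 = (d+1)·p^k`** — no class of degree `n` is a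
  Siegel form exactly when `n = (d+1)p^k − 1` (e.g. `p = 2`: `n + 1` a power of `2`), and **`apolar_nondegenerate_iff_exists_digits`** (J7: the apolar pairing of degree `n` is
  non-degenerate in characteristic `p` iff `n + 1 = (d+1)·p^k`, `d < p`).
NOT typed here: anything Ext-side.  New names only.
-/

open Module

namespace Summit.Ventures.HSemireg.Wedge.KernelDuality

open Summit.Ventures.HSemireg.Wedge Summit.Ventures.HSemireg.Wedge.Kunneth Summit.Ventures.HSemireg.Wedge.Hankel
  Summit.Ventures.HSemireg.Wedge.BasisFree Summit.Ventures.HSemireg.Wedge.HankelSiegel Summit.Ventures.HSemireg.Wedge.HankelSiegelIdeal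
  Summit.Ventures.HSemireg.Wedge.KunnethKernel Summit.Ventures.HSemireg.Wedge.HankelRankOne Summit.Ventures.HSemireg.Wedge.HankelFrameChange

variable (K : Type*) [Field K] {n : ℕ}

/-! ## §260. The digit recursion of `Π_i (n_i + 1)` and when it reaches `n + 1` -/

section Digits

variable {p : ℕ}

/-- the recursion: `Π(n) = (n mod p + 1) · Π(⌊n/p⌋)` for `n > 0` (`p ≥ 2`). -/
theorem prod_digits_succ (hp : 2 ≤ p) {m : ℕ} (hm : 0 < m) :
    ((Nat.digits p m).map (· + 1)).prod = (m % p + 1) * ((Nat.digits p (m / p)).map (· + 1)).prod := by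
  rw [Nat.digits_of_two_le_of_pos hp hm, List.map_cons, List.prod_cons]

/-- `Π(n) ≤ n + 1` for every `p ≥ 2` (the digit recursion and `(r+1)(q+1) ≤ p·q + r + 1` for `r < p`). -/
theorem prod_digits_succ_le_succ (hp : 2 ≤ p) : ∀ m : ℕ, ((Nat.digits p m).map (· + 1)).prod ≤ m + 1 := by
  intro m
  induction m using Nat.strong_induction_on with
  | _ m ih =>
    rcases Nat.eq_zero_or_pos m with rfl | hm
    · rw [Nat.digits_zero, List.map_nil, List.prod_nil]
      exact le_rfl
    · rw [prod_digits_succ hp hm]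
      have h1 := ih (m / p) (Nat.div_lt_self hm (by omega))
      have hr : m % p < p := Nat.mod_lt m (by omega)
      have hdm : p * (m / p) + m % p = m := Nat.div_add_mod m p
      have h2 : m % p * (m / p) ≤ (p - 1) * (m / p) := Nat.mul_le_mul_right _ (by omega)
      have h3 : (p - 1) * (m / p) + m / p = p * (m / p) := by
        rw [Nat.sub_one_mul]; exact Nat.sub_add_cancel (Nat.le_mul_of_pos_left _ (by omega))
      calc (m % p + 1) * ((Nat.digits p (m / p)).map (· + 1)).prod ≤ (m % p + 1) * (m / p + 1) := Nat.mul_le_mul_left _ h1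
        _ ≤ m + 1 := by nlinarith [h2, h3, hdm]

/-- **`Π(n) = n + 1 ⇔ n < p ∨ (n mod p = p − 1 ∧ Π(⌊n/p⌋) = ⌊n/p⌋ + 1)`** (`p ≥ 2`). -/
theorem prod_digits_succ_eq_succ_iff (hp : 2 ≤ p) (m : ℕ) :
    ((Nat.digits p m).map (· + 1)).prod = m + 1 ↔ m < p ∨ (m % p = p - 1 ∧ ((Nat.digits p (m / p)).map (· + 1)).prod = m / p + 1) := by
  rcases Nat.eq_zero_or_pos m with rfl | hm
  · rw [Nat.digits_zero, List.map_nil, List.prod_nil]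
    exact ⟨fun _ => Or.inl (by omega), fun _ => rfl⟩
  rw [prod_digits_succ hp hm]
  have h1 := prod_digits_succ_le_succ hp (m / p)
  have hr : m % p < p := Nat.mod_lt m (by omega)
  have hdm : p * (m / p) + m % p = m := Nat.div_add_mod m p
  set P := ((Nat.digits p (m / p)).map (· + 1)).prod with hP
  constructor
  · intro h
    by_cases hlt : m < p
    · exact Or.inl hlt
    · right
      have hq : 0 < m / p := Nat.div_pos (not_lt.mp hlt) (by omega)
      -- `(r+1)·P = p·q + r + 1` with `P ≤ q + 1`, `r ≤ p − 1`, `q ≥ 1` forces `P = q + 1` and `r = p − 1`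
      have hPq : P = m / p + 1 := by
        by_contra hne
        have hlt' : P ≤ m / p := by omega
        have : (m % p + 1) * P ≤ (m % p + 1) * (m / p) := Nat.mul_le_mul_left _ hlt'
        nlinarith
      refine ⟨?_, hPq⟩
      rw [hPq] at h
      -- `(r+1)(q+1) = pq + r + 1` ⇒ `q(r+1) = pq` ⇒ `r + 1 = p`
      have h2 : (m / p) * (m % p + 1) = (m / p) * p := by nlinarith
      have h3 := Nat.eq_of_mul_eq_mul_left hq h2
      omega
  · rintro (hlt | ⟨hr', hPq⟩)
    · rw [hP, Nat.div_eq_of_lt hlt, Nat.digits_zero, List.map_nil, List.prod_nil, mul_one, Nat.mod_eq_of_lt hlt]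
    · rw [hPq, hr']
      have hp1 : p - 1 + 1 = p := by omega
      rw [hp1]
      have hm' : m % p = p - 1 := hr'
      nlinarith [hdm, hm', hp1]

/-- **`Π(n) = n + 1 ⇔ ∃ k d, d < p ∧ n + 1 = (d+1)·p^k`** — all base-`p` digits of `n` below the leading digit `d` are `p − 1` (`p ≥ 2`). -/
theorem prod_digits_succ_eq_succ_iff_exists (hp : 2 ≤ p) : ∀ m : ℕ,
    ((Nat.digits p m).map (· + 1)).prod = m + 1 ↔ ∃ k d : ℕ, d < p ∧ m + 1 = (d + 1) * p ^ k := by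
  intro m
  induction m using Nat.strong_induction_on with
  | _ m ih =>
    rw [prod_digits_succ_eq_succ_iff hp m]
    constructor
    · rintro (hlt | ⟨hr, hP⟩)
      · exact ⟨0, m, hlt, by rw [pow_zero, mul_one]⟩
      · have hm : 0 < m := by
          by_contra h0
          have : m = 0 := by omega
          subst this
          rw [Nat.zero_mod] at hr; omega
        obtain ⟨k, d, hd, hk⟩ := (ih (m / p) (Nat.div_lt_self hm (by omega))).mp hP
        refine ⟨k + 1, d, hd, ?_⟩
        have hdm : p * (m / p) + m % p = m := Nat.div_add_mod m p
        rw [pow_succ, ← mul_assoc, ← hk]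
        have : p - 1 + 1 = p := by omega
        nlinarith [hdm, hr, this]
    · rintro ⟨k, d, hd, hk⟩
      rcases k with _ | k
      · left
        rw [pow_zero, mul_one] at hk
        omega
      · right
        have hm1 : m + 1 = p * ((d + 1) * p ^ k) := by rw [hk, pow_succ]; ring
        have hpos : 0 < (d + 1) * p ^ k := Nat.mul_pos (Nat.succ_pos d) (Nat.pow_pos (by omega))
        have hm0 : 0 < m := by
          have := Nat.mul_le_mul hp (Nat.one_le_iff_ne_zero.mpr hpos.ne')
          omega
        -- `m = p·((d+1)p^k − 1) + (p − 1)`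
        have hq : m / p = (d + 1) * p ^ k - 1 := by
          have e : m = p * ((d + 1) * p ^ k - 1) + (p - 1) := by
            have := Nat.sub_add_cancel (Nat.one_le_iff_ne_zero.mpr hpos.ne')
            zify [hp, Nat.one_le_iff_ne_zero.mpr hpos.ne', show 1 ≤ p by omega] at hm1 ⊢
            linarith
          rw [e, Nat.mul_add_div (by omega), Nat.div_eq_of_lt (by omega), add_zero]
        have hr : m % p = p - 1 := by
          have e : m = p * ((d + 1) * p ^ k - 1) + (p - 1) := by
            zify [hp, Nat.one_le_iff_ne_zero.mpr hpos.ne', show 1 ≤ p by omega] at hm1 ⊢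
            linarith
          rw [e, Nat.mul_add_mod, Nat.mod_eq_of_lt (by omega)]
        refine ⟨hr, (ih (m / p) (Nat.div_lt_self hm0 (by omega))).mpr ⟨k, d, hd, ?_⟩⟩
        rw [hq, Nat.sub_add_cancel (Nat.one_le_iff_ne_zero.mpr hpos.ne')]

end Digits

/-! ## §261. The reading for th-7's Siegel classes -/

/-- **IN CHARACTERISTIC `p`: `coSiegel_n ⊓ SI_n = ⊥ ⇔ ∃ k d, d < p ∧ n + 1 = (d+1)·p^k`** — no class of degree `n` is a Siegel form exactly when all base-`p` digits of `n` below the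
leading one are `p − 1` (J15's `Π_i (n_i + 1) = n + 1`, read arithmetically). -/
theorem coSiegel_inf_siegelIdeal_eq_bot_iff_exists_digits (p : ℕ) [CharP K p] (hp : p.Prime) :
    coSiegel K n n ⊓ siegelIdeal K n n = ⊥ ↔ ∃ k d : ℕ, d < p ∧ n + 1 = (d + 1) * p ^ k := by
  rw [coSiegel_inf_siegelIdeal_eq_bot_iff_prod_digits K p hp, prod_digits_succ_eq_succ_iff_exists hp.two_le]

/-- **the apolar pairing of degree `n` is NON-DEGENERATE in characteristic `p` iff `n + 1 = (d+1)·p^k` with `d < p`** (J7 `apolar_nondegenerate_iff` + J15 + §260). -/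
theorem apolar_nondegenerate_iff_exists_digits (p : ℕ) [CharP K p] (hp : p.Prime) :
    (∀ q : ℕ → K, (∀ q' : ℕ → K, apolar K n q q' = 0) → ∀ j ≤ n, q j = 0) ↔ ∃ k d : ℕ, d < p ∧ n + 1 = (d + 1) * p ^ k := by
  rw [apolar_nondegenerate_iff, ← coSiegel_inf_siegelIdeal_eq_bot_iff, coSiegel_inf_siegelIdeal_eq_bot_iff_exists_digits K p hp]

end Summit.Ventures.HSemireg.Wedge.KernelDuality
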